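import Summits.KontsevichZagierPeriods.KontsevichZagierPeriods.Theses.CyclesAsDomains

/-!
# Crux `ClosedFormCompleteness` (stmt-KontsevichZagierPeriods-6591) — birth skeleton (`Lines/birth.lean`, BC3)

Route `CyclesAsDomains`, item `ClosedFormCompleteness` (auto-crux, conjecture-grade OPEN CORE of the route):
`ker KZ.eval ≤ closure G`, where `G` = domain additivity (1a) ∪ integrand additivity (1b) ∪ change of
variables (2) ∪ padding slabs `[σ×[j,j+1], f∘init] − [σ,f]` ∪ the ZERO-BULK STOKES ELEMENTS of the route's engine
`ZeroBulkStokes` (stmt 6589) — Conjecture 1 presented on the generators the engine produces, rule (3) removed.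

The skeleton cuts the crux along the standard architecture of a completeness proof for a calculus —
NORMAL FORM · GENERATION · KERNEL ON NORMAL FORMS — into three named stubs, all load-bearing in the
composition:

* `stub_cubeNormalForm` (provable-class, size M–L; tools landed: `KZ.exists_integralRep_sub_holds`,
  `KZ.IntegralRep.exists_of_add_of_sub_of_mem_relations` (disjoint-translation merging), `KZ.IntegralRep.slab` /
  `equivalent_slab` (common dimension), `KZ.of_add_of_mem_relations_of_eqOn_neg`, `KZ.IntegralRep.glue`,
  `of_empty_mem_relations`; missing piece: compactification of an unbounded domain into the unit cube by the
  rule-(2) charts `xᵢ ↦ xᵢ/(1+xᵢ)` on sign cells + extension by `0` + one affine map): every formal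
  `ℤ`-combination is congruent MODULO THE MOVES to ONE representation whose domain is the closed unit cube.
  (Much weaker than the shared crux `CubeNashNormalForm` of DimensionBudget / LiftingCriteria /
  SymplecticScissors: no analyticity, no resolution of singularities, one cube instead of a signed sum.)
* `stub_newtonLeibnizElimination` (provable-class, size M–L): every Newton–Leibniz relator (rule (3)) already
  lies in `closure G` — RULE (3) IS A ZERO-BULK STOKES ELEMENT ONE DIMENSION UP: for a straight band
  `[0,1]^n × [0,1]` with primitive `F` (normalised to `F(x,0) = 0`) take, on the `(n+2)`-cube with the dummy
  coordinate `u`, the closed coefficient system `A_n = F(x,t)`, `A_(n+1) = u · f(x,t)`, all other `A_k = 0`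
  (`B_n = B_(n+1) = f`, so `Σ (−1)^k B_k = 0` pointwise on the open cube); its zero-bulk element is
  `±(([C, F(·,1)] − [C, 0]) − ([C, f] − [C, 0]))`, and `[C, F(·,1)]` is the slab of the base representation —
  so `[band, f] − [base, F(·,1) − F(·,0)] ∈ closure G` by slabs, integrand additivity and `[C,0] ∈ closure G`;
  a general band `{a ≤ t ≤ b}` over `τ` is straightened cell by cell by rule (2) (`t = a + s(b−a)` on the
  `C¹`-cells of `a`, `b`, null cells discarded by rule (1a)). This is the route reviewer's structural reading
  (refuter c310f3d6, note on stmt 6591) made a lemma; it is implied by, but much weaker than,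
  `ScissorsTransport.NewtonLeibnizElimination` (stmt 2668: rule (3) ⊆ closure of rules (1),(2) and slabs ALONE,
  a shear/degree argument), because here the zero-bulk elements are among the generators.
* `stub_cubeKernel` (conjecture-grade — the transcendence content, the crux CUT DOWN TO ITS CUBE SECTOR): a single
  representation on the closed unit cube with value `0` lies in `closure G` ("a vanishing cube integral is
  certified by closed semialgebraic coefficient systems, up to scissors and padding"). Implied by the crux
  (`c := [r]`); gives it back only through the two lemmas above.

Composition (`ClosedFormCompleteness_of_stubs`, arrow form, sorry-free; `ClosedFormCompleteness_of`, the crux BY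
NAME from the three stubs by name — the skeleton audit `#h21_check_skeleton` admits no inline `Prop` binders, so
the by-name theorem feeds the registered stubs to the arrow form): given `c` with `eval c = 0`, normalise
`c ≡ [r]` modulo `KZ.relations` (stub 1); `KZ.relations ≤ closure G` because rules (1a), (1b), (2) are literally
in `G` and rule (3) is stub 2 (`AddSubgroup.closure_le`, four cases); soundness `KZ.relations_le_ker_eval_holds`
gives `r.value = eval c = 0`; stub 3 puts `[r]` in `closure G`; hence `c = (c − [r]) + [r] ∈ closure G`.

BC3 probes (registrar's folder `bc/probe_*.lean`, battery `first | exact? | simpa | simpa [Crux] | (unfold Crux;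
simpa) | aesop`, 400 000 heartbeats): for each stub, `stub → ClosedFormCompleteness` and
`stub → KontsevichZagierPeriods` FAIL (outputs quoted in the registrar's NOTES.md) — no stub is cheaply the crux
or the summit: stubs 1 and 2 are move bookkeeping with no transcendence content, stub 3 reaches the crux only
through stubs 1–2 and the summit only through stubs 1–2, `ZeroBulkStokes` (stmt 6589, open) and the proved
kernel-implies-statement glue.

Disproof used: none on record (`ledger crux ls stmt-KontsevichZagierPeriods-6591`: no workfiles, no
Disproof.lean; negatives index of the summit: 1 entry, `KinematicPlaneConvex` via `K = ∅`, unrelated — each stub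
is checked on degenerate data: `c = 0 ↦ r = [cube, 0]` (in `relations` by integrand additivity), the empty /
null band (both sides of rule (3) are null representations, in `closure G` by rule (1a) with `σ₁ = σ₂`),
`N = 0` (the cube is the point, `value = integrand default = 0 ⇒ [pt, f] ∈ closure G` by integrand additivity)).
-/

noncomputable section

open Literature.NumberTheory.Transcendental

namespace Summit.KontsevichZagierPeriods.KontsevichZagierPeriods.Cruxes.ClosedFormCompleteness.Birth

/-! ### Registered stubs -/

/-- **STUB 1 (provable-class, size M–L) — single closed-cube normal form modulo the moves.** Every formal
`ℤ`-combination of integral representations is congruent, modulo `KZ.relations`, to ONE representation whose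
domain is the closed unit cube `[0,1]^N` (some `N`). Plan: `c ≡ [A] − [B]` (`KZ.exists_integralRep_sub_holds`);
`−[B] ≡ [B.neg]` (`KZ.of_add_of_mem_relations_of_eqOn_neg`); merge by disjoint translation in a common dimension
(`KZ.IntegralRep.exists_of_add_of_sub_of_mem_relations`, slabs); compactify the domain by the rule-(2) charts
`xᵢ ↦ xᵢ/(1+xᵢ)` / `xᵢ ↦ xᵢ/(1−xᵢ)` on the `3^N` sign cells (coordinate hyperplanes are null, rule (1a)),
Jacobian `∏ (1−yᵢ)^(−2)` semialgebraic, integrability by `MeasureTheory.integrableOn_image_iff_…`; extend by `0`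
to a cube (rule (1a) with `[σ, 0] ∈ relations`) and rescale affinely. Why it might fail: only by a mistyped
field (the representation must carry an integrand integrable on the whole closed cube — extension by `0` does it).
[KontsevichZagier2001 §1.2 rules (1), (2); ViuSos2021 §2.2 (compactification by charts); in-tree
`KZ.semiCanonicalReduction_holds` for the signed bounded-volume variant] -/
theorem stub_cubeNormalForm :
    ∀ c : Literature.NumberTheory.Transcendental.KZ.FormalRep, ∃ (N : ℕ) (r : Literature.NumberTheory.Transcendental.KZ.IntegralRep N), r.domain = {x | ∀ i, x i ∈ Set.Icc (0:ℝ) 1} ∧ c - Literature.NumberTheory.Transcendental.KZ.of r ∈ Literature.NumberTheory.Transcendental.KZ.relations := by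
  sorry

/-- **STUB 2 (provable-class, size M–L) — Newton–Leibniz elimination into zero-bulk form.** Every instance of
rule (3) lies in the subgroup generated by rules (1a), (1b), (2), the padding slabs and the zero-bulk Stokes
elements (the generator set `G` of the crux, verbatim): on a straight band it IS a zero-bulk element on the
`(n+2)`-cube with the dummy coordinate `u` (`A_n = F − F(·,0)`, `A_(n+1) = u·f`, other `A_k = 0`; faces
`[C, F(·,1) − F(·,0)] = slab of the base`, `[C, f]`, twice `[C, 0]`), and a general band over `τ` is straightened
cell by cell by rule (2) on the `C¹`-cells of `a`, `b` (null cells are rule-(1a) relators). Implied by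
`ScissorsTransport.NewtonLeibnizElimination` (stmt 2668) by `AddSubgroup.closure_mono`, but needs no shear /
degree argument. Why it might fail: the `C¹`-cell decomposition of the semialgebraic endpoint functions `a ≤ b`
and the transport of the fibrewise regularity of `F` through the straightening chart must be supplied inside
`IsSemialgebraicFunOn` / `HasFDerivWithinAt` bookkeeping (BochnakCosteRoy1998 §2.9, §9.1); no transcendence
content. [KontsevichZagier2001 §1.2 rule (3); Ayoub2015 Rem. 1.5; refuter c310f3d6 note on stmt 6591] -/
theorem stub_newtonLeibnizElimination :
    ∀ c ∈ Literature.NumberTheory.Transcendental.KZ.newtonLeibnizRel, c ∈ AddSubgroup.closure (Literature.NumberTheory.Transcendental.KZ.domainAddRel ∪ Literature.NumberTheory.Transcendental.KZ.integrandAddRel ∪ Literature.NumberTheory.Transcendental.KZ.changeOfVariablesRel ∪ {c | ∃ (n : ℕ) (r : Literature.NumberTheory.Transcendental.KZ.IntegralRep n) (j : ℕ), c = Literature.NumberTheory.Transcendental.KZ.of (r.slab j) - Literature.NumberTheory.Transcendental.KZ.of r} ∪ {c | ∃ (d : ℕ) (A : Fin (d + 1) → (Fin (d + 1) → ℝ)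 → ℝ) (B : Fin (d + 1) → (Fin (d + 1) → ℝ) → ℝ) (ρ₁ ρ₀ : Fin (d + 1) → Literature.NumberTheory.Transcendental.KZ.IntegralRep d), (∀ k, Literature.NumberTheory.Transcendental.IsSemialgebraicFunOn ℚ {z : Fin (d + 1) → ℝ | ∀ i, z i ∈ Set.Icc (0:ℝ) 1} (A k)) ∧ (∀ k, Literature.NumberTheory.Transcendental.IsSemialgebraicFunOn ℚ {z : Fin (d + 1) → ℝ | ∀ i, z i ∈ Set.Icc (0:ℝ) 1} (B k)) ∧ (∀ k, MeasureTheory.IntegrableOn (B k) {z : Fin (d + 1) → ℝ | ∀ i, z i ∈ Set.Icc (0:ℝ) 1}) ∧ (∀ k, ∀ x : Fin d → ℝ, (∀ i, x i ∈ Set.Icc (0:ℝ) 1) → ContinuousOn (fun t : ℝ => A k (Fin.insertNth k t x)) (Set.Icc 0 1) ∧ ∀ t ∈ Set.Ioo (0:ℝ) 1, HasDerivAt (fun s : ℝ => A k (Fin.insertNth k s x)) (B k (Fin.insertNth k t x)) t) ∧ (∀ z : Fin (d + 1) → ℝ, (∀ i, z i ∈ Set.Ioo (0:ℝ) 1) →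 ∑ k : Fin (d + 1), (-1 : ℝ) ^ (k : ℕ) * B k z = 0) ∧ (∀ k, (ρ₁ k).domain = {x | ∀ i, x i ∈ Set.Icc (0:ℝ) 1} ∧ (ρ₀ k).domain = {x | ∀ i, x i ∈ Set.Icc (0:ℝ) 1} ∧ Set.EqOn (ρ₁ k).integrand (fun x => A k (Fin.insertNth k 1 x)) {x | ∀ i, x i ∈ Set.Icc (0:ℝ) 1} ∧ Set.EqOn (ρ₀ k).integrand (fun x => A k (Fin.insertNth k 0 x)) {x | ∀ i, x i ∈ Set.Icc (0:ℝ) 1}) ∧ c = ∑ k : Fin (d + 1), ((-1 : ℤ) ^ (k : ℕ)) • (Literature.NumberTheory.Transcendental.KZ.of (ρ₁ k) - Literature.NumberTheory.Transcendental.KZ.of (ρ₀ k))}) := by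
  sorry

/-- **STUB 3 (conjecture-grade) — completeness on the cube sector.** A single integral representation on the
closed unit cube `[0,1]^N` with value `0` lies in the subgroup generated by `G` (scissors, padding and zero-bulk
Stokes certificates): "every vanishing cube integral is the boundary of closed `ℚ`-semialgebraic coefficient
systems on cubes, up to scissors and padding" — the calculus-internal shadow of Kontsevich's formal period
conjecture restricted to one affine chart. It is the special case `c := [r]` of the crux and returns the crux
only through stubs 1–2; it is NOT linked to the summit by any landed theorem (the summit needs, besides stubs 1–2,
`ZeroBulkStokes` and the kernel-implies-statement glue). Why it might fail: iff Conjecture 1 fails, or rule (3)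
with non-closed data is genuinely needed beyond what padding recovers (excluded by stub 2). Size: open problem.
[KontsevichZagier2001 §1.2 Conjecture 1, §4.1; HuberMullerStach2017 Conj. 13.2.1; Ayoub2015 Conj. 1.1] -/
theorem stub_cubeKernel :
    ∀ (N : ℕ) (r : Literature.NumberTheory.Transcendental.KZ.IntegralRep N), r.domain = {x | ∀ i, x i ∈ Set.Icc (0:ℝ) 1} → r.value = 0 → Literature.NumberTheory.Transcendental.KZ.of r ∈ AddSubgroup.closure (Literature.NumberTheory.Transcendental.KZ.domainAddRel ∪ Literature.NumberTheory.Transcendental.KZ.integrandAddRel ∪ Literature.NumberTheory.Transcendental.KZ.changeOfVariablesRel ∪ {c | ∃ (n : ℕ) (r : Literature.NumberTheory.Transcendental.KZ.IntegralRep n) (j : ℕ), c = Literature.NumberTheory.Transcendental.KZ.of (r.slab j) - Literature.NumberTheory.Transcendental.KZ.of r} ∪ {c | ∃ (d : ℕ) (A : Fin (d + 1) → (Fin (d + 1) → ℝ) → ℝ) (B : Fin (d + 1) → (Fin (d + 1) → ℝ) → ℝ) (ρ₁ ρ₀ : Fin (d + 1) → Literature.NumberTheory.Transcendental.KZ.IntegralRep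 d), (∀ k, Literature.NumberTheory.Transcendental.IsSemialgebraicFunOn ℚ {z : Fin (d + 1) → ℝ | ∀ i, z i ∈ Set.Icc (0:ℝ) 1} (A k)) ∧ (∀ k, Literature.NumberTheory.Transcendental.IsSemialgebraicFunOn ℚ {z : Fin (d + 1) → ℝ | ∀ i, z i ∈ Set.Icc (0:ℝ) 1} (B k)) ∧ (∀ k, MeasureTheory.IntegrableOn (B k) {z : Fin (d + 1) → ℝ | ∀ i, z i ∈ Set.Icc (0:ℝ) 1}) ∧ (∀ k, ∀ x : Fin d → ℝ, (∀ i, x i ∈ Set.Icc (0:ℝ) 1) → ContinuousOn (fun t : ℝ => A k (Fin.insertNth k t x)) (Set.Icc 0 1) ∧ ∀ t ∈ Set.Ioo (0:ℝ) 1, HasDerivAt (fun s : ℝ => A k (Fin.insertNth k s x)) (B k (Fin.insertNth k t x)) t) ∧ (∀ z : Fin (d + 1) → ℝ, (∀ i, z i ∈ Set.Ioo (0:ℝ) 1) → ∑ k : Fin (d + 1), (-1 : ℝ) ^ (k : ℕ) * B k z = 0) ∧ (∀ k, (ρ₁ k).domain = {x | ∀ i, x i ∈ Set.Icc (0:ℝ)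 1} ∧ (ρ₀ k).domain = {x | ∀ i, x i ∈ Set.Icc (0:ℝ) 1} ∧ Set.EqOn (ρ₁ k).integrand (fun x => A k (Fin.insertNth k 1 x)) {x | ∀ i, x i ∈ Set.Icc (0:ℝ) 1} ∧ Set.EqOn (ρ₀ k).integrand (fun x => A k (Fin.insertNth k 0 x)) {x | ∀ i, x i ∈ Set.Icc (0:ℝ) 1}) ∧ c = ∑ k : Fin (d + 1), ((-1 : ℤ) ^ (k : ℕ)) • (Literature.NumberTheory.Transcendental.KZ.of (ρ₁ k) - Literature.NumberTheory.Transcendental.KZ.of (ρ₀ k))}) := by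
  sorry

/-! ### Composition (no `sorry` below this line) -/

/-- **Composition, arrow form** (`<stub₁-sig> → <stub₂-sig> → <stub₃-sig> →` the crux, whose body is written
out so that the by-name audit sees exactly one candidate theorem, `ClosedFormCompleteness_of` below): normal
form modulo moves, `relations ≤ closure G` (rules (1a), (1b), (2) are in `G`; rule (3) by the elimination
hypothesis), soundness of the moves (`KZ.relations_le_ker_eval_holds`) to read `r.value = 0`, the cube-sector
kernel, and `c = (c − [r]) + [r]`. [folklore] -/
theorem ClosedFormCompleteness_of_stubs
    (h₁ : ∀ c : Literature.NumberTheory.Transcendental.KZ.FormalRep, ∃ (N : ℕ) (r : Literature.NumberTheory.Transcendental.KZ.IntegralRep N), r.domain = {x | ∀ i, x i ∈ Set.Icc (0:ℝ) 1} ∧ c - Literature.NumberTheory.Transcendental.KZ.of r ∈ Literature.NumberTheory.Transcendental.KZ.relations)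
    (h₂ : ∀ c ∈ Literature.NumberTheory.Transcendental.KZ.newtonLeibnizRel, c ∈ AddSubgroup.closure (Literature.NumberTheory.Transcendental.KZ.domainAddRel ∪ Literature.NumberTheory.Transcendental.KZ.integrandAddRel ∪ Literature.NumberTheory.Transcendental.KZ.changeOfVariablesRel ∪ {c | ∃ (n : ℕ) (r : Literature.NumberTheory.Transcendental.KZ.IntegralRep n) (j : ℕ), c = Literature.NumberTheory.Transcendental.KZ.of (r.slab j) - Literature.NumberTheory.Transcendental.KZ.of r} ∪ {c | ∃ (d : ℕ) (A : Fin (d + 1) → (Fin (d + 1) → ℝ) → ℝ) (B : Fin (d + 1) → (Fin (d + 1) → ℝ) → ℝ) (ρ₁ ρ₀ : Fin (d + 1) → Literature.NumberTheory.Transcendental.KZ.IntegralRep d), (∀ k, Literature.NumberTheory.Transcendental.IsSemialgebraicFunOn ℚ {z : Fin (d + 1) → ℝ | ∀ i, z i ∈ Set.Icc (0:ℝ) 1} (A k)) ∧ (∀ k, Literature.NumberTheory.Transcendental.IsSemialgebraicFunOn ℚ {z : Fin (d + 1) → ℝ | ∀ i, z i ∈ Set.Icc (0:ℝ) 1} (B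 k)) ∧ (∀ k, MeasureTheory.IntegrableOn (B k) {z : Fin (d + 1) → ℝ | ∀ i, z i ∈ Set.Icc (0:ℝ) 1}) ∧ (∀ k, ∀ x : Fin d → ℝ, (∀ i, x i ∈ Set.Icc (0:ℝ) 1) → ContinuousOn (fun t : ℝ => A k (Fin.insertNth k t x)) (Set.Icc 0 1) ∧ ∀ t ∈ Set.Ioo (0:ℝ) 1, HasDerivAt (fun s : ℝ => A k (Fin.insertNth k s x)) (B k (Fin.insertNth k t x)) t) ∧ (∀ z : Fin (d + 1) → ℝ, (∀ i, z i ∈ Set.Ioo (0:ℝ) 1) → ∑ k : Fin (d + 1), (-1 : ℝ) ^ (k : ℕ) * B k z = 0) ∧ (∀ k, (ρ₁ k).domain = {x | ∀ i, x i ∈ Set.Icc (0:ℝ) 1} ∧ (ρ₀ k).domain = {x | ∀ i, x i ∈ Set.Icc (0:ℝ) 1} ∧ Set.EqOn (ρ₁ k).integrand (fun x => A k (Fin.insertNth k 1 x)) {x | ∀ i, x i ∈ Set.Icc (0:ℝ) 1} ∧ Set.EqOn (ρ₀ k).integrand (fun x => A k (Fin.insertNth k 0 x)) {x | ∀ i,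 x i ∈ Set.Icc (0:ℝ) 1}) ∧ c = ∑ k : Fin (d + 1), ((-1 : ℤ) ^ (k : ℕ)) • (Literature.NumberTheory.Transcendental.KZ.of (ρ₁ k) - Literature.NumberTheory.Transcendental.KZ.of (ρ₀ k))}))
    (h₃ : ∀ (N : ℕ) (r : Literature.NumberTheory.Transcendental.KZ.IntegralRep N), r.domain = {x | ∀ i, x i ∈ Set.Icc (0:ℝ) 1} → r.value = 0 → Literature.NumberTheory.Transcendental.KZ.of r ∈ AddSubgroup.closure (Literature.NumberTheory.Transcendental.KZ.domainAddRel ∪ Literature.NumberTheory.Transcendental.KZ.integrandAddRel ∪ Literature.NumberTheory.Transcendental.KZ.changeOfVariablesRel ∪ {c | ∃ (n : ℕ) (r : Literature.NumberTheory.Transcendental.KZ.IntegralRep n) (j : ℕ), c = Literature.NumberTheory.Transcendental.KZ.of (r.slab j) - Literature.NumberTheory.Transcendental.KZ.of r} ∪ {c | ∃ (d : ℕ) (A : Fin (d + 1) → (Fin (d + 1) → ℝ) → ℝ) (B : Fin (d + 1) → (Fin (d + 1) → ℝ) → ℝ) (ρ₁ ρ₀ : Fin (d + 1) → Literature.NumberTheory.Transcendental.KZ.IntegralRep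 d), (∀ k, Literature.NumberTheory.Transcendental.IsSemialgebraicFunOn ℚ {z : Fin (d + 1) → ℝ | ∀ i, z i ∈ Set.Icc (0:ℝ) 1} (A k)) ∧ (∀ k, Literature.NumberTheory.Transcendental.IsSemialgebraicFunOn ℚ {z : Fin (d + 1) → ℝ | ∀ i, z i ∈ Set.Icc (0:ℝ) 1} (B k)) ∧ (∀ k, MeasureTheory.IntegrableOn (B k) {z : Fin (d + 1) → ℝ | ∀ i, z i ∈ Set.Icc (0:ℝ) 1}) ∧ (∀ k, ∀ x : Fin d → ℝ, (∀ i, x i ∈ Set.Icc (0:ℝ) 1) → ContinuousOn (fun t : ℝ => A k (Fin.insertNth k t x)) (Set.Icc 0 1) ∧ ∀ t ∈ Set.Ioo (0:ℝ) 1, HasDerivAt (fun s : ℝ => A k (Fin.insertNth k s x)) (B k (Fin.insertNth k t x)) t) ∧ (∀ z : Fin (d + 1) → ℝ, (∀ i, z i ∈ Set.Ioo (0:ℝ) 1) → ∑ k : Fin (d + 1), (-1 : ℝ) ^ (k : ℕ) * B k z = 0) ∧ (∀ k, (ρ₁ k).domain = {x | ∀ i, x i ∈ Set.Icc (0:ℝ)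 1} ∧ (ρ₀ k).domain = {x | ∀ i, x i ∈ Set.Icc (0:ℝ) 1} ∧ Set.EqOn (ρ₁ k).integrand (fun x => A k (Fin.insertNth k 1 x)) {x | ∀ i, x i ∈ Set.Icc (0:ℝ) 1} ∧ Set.EqOn (ρ₀ k).integrand (fun x => A k (Fin.insertNth k 0 x)) {x | ∀ i, x i ∈ Set.Icc (0:ℝ) 1}) ∧ c = ∑ k : Fin (d + 1), ((-1 : ℤ) ^ (k : ℕ)) • (Literature.NumberTheory.Transcendental.KZ.of (ρ₁ k) - Literature.NumberTheory.Transcendental.KZ.of (ρ₀ k))})) :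
    ∀ c : Literature.NumberTheory.Transcendental.KZ.FormalRep, Literature.NumberTheory.Transcendental.KZ.eval c = 0 → c ∈ AddSubgroup.closure (Literature.NumberTheory.Transcendental.KZ.domainAddRel ∪ Literature.NumberTheory.Transcendental.KZ.integrandAddRel ∪ Literature.NumberTheory.Transcendental.KZ.changeOfVariablesRel ∪ {c | ∃ (n : ℕ) (r : Literature.NumberTheory.Transcendental.KZ.IntegralRep n) (j : ℕ), c = Literature.NumberTheory.Transcendental.KZ.of (r.slab j) - Literature.NumberTheory.Transcendental.KZ.of r} ∪ {c | ∃ (d : ℕ) (A : Fin (d + 1) → (Fin (d + 1) → ℝ) → ℝ) (B : Fin (d + 1) → (Fin (d + 1) → ℝ) → ℝ) (ρ₁ ρ₀ : Fin (d + 1) → Literature.NumberTheory.Transcendental.KZ.IntegralRep d), (∀ k, Literature.NumberTheory.Transcendental.IsSemialgebraicFunOn ℚ {z : Fin (d + 1) → ℝ | ∀ i, z i ∈ Set.Icc (0:ℝ) 1} (A k)) ∧ (∀ k, Literature.NumberTheory.Transcendental.IsSemialgebraicFunOn ℚ {z : Fin (d + 1) → ℝ | ∀ i, z i ∈ Set.Icc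 (0:ℝ) 1} (B k)) ∧ (∀ k, MeasureTheory.IntegrableOn (B k) {z : Fin (d + 1) → ℝ | ∀ i, z i ∈ Set.Icc (0:ℝ) 1}) ∧ (∀ k, ∀ x : Fin d → ℝ, (∀ i, x i ∈ Set.Icc (0:ℝ) 1) → ContinuousOn (fun t : ℝ => A k (Fin.insertNth k t x)) (Set.Icc 0 1) ∧ ∀ t ∈ Set.Ioo (0:ℝ) 1, HasDerivAt (fun s : ℝ => A k (Fin.insertNth k s x)) (B k (Fin.insertNth k t x)) t) ∧ (∀ z : Fin (d + 1) → ℝ, (∀ i, z i ∈ Set.Ioo (0:ℝ) 1) → ∑ k : Fin (d + 1), (-1 : ℝ) ^ (k : ℕ) * B k z = 0) ∧ (∀ k, (ρ₁ k).domain = {x | ∀ i, x i ∈ Set.Icc (0:ℝ) 1} ∧ (ρ₀ k).domain = {x | ∀ i, x i ∈ Set.Icc (0:ℝ) 1} ∧ Set.EqOn (ρ₁ k).integrand (fun x => A k (Fin.insertNth k 1 x)) {x | ∀ i, x i ∈ Set.Icc (0:ℝ) 1} ∧ Set.EqOn (ρ₀ k).integrand (fun x => A k (Fin.insertNth k 0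 x)) {x | ∀ i, x i ∈ Set.Icc (0:ℝ) 1}) ∧ c = ∑ k : Fin (d + 1), ((-1 : ℤ) ^ (k : ℕ)) • (Literature.NumberTheory.Transcendental.KZ.of (ρ₁ k) - Literature.NumberTheory.Transcendental.KZ.of (ρ₀ k))}) := by
  intro c hc
  obtain ⟨N, r, hdom, hrel⟩ := h₁ c
  -- every KZ relation is generated by `G`: rules (1a), (1b), (2) verbatim, rule (3) by elimination
  have hRG : KZ.relations ≤ AddSubgroup.closure (Literature.NumberTheory.Transcendental.KZ.domainAddRel ∪ Literature.NumberTheory.Transcendental.KZ.integrandAddRel ∪ Literature.NumberTheory.Transcendental.KZ.changeOfVariablesRel ∪ {c | ∃ (n : ℕ) (r : Literature.NumberTheory.Transcendental.KZ.IntegralRep n) (j : ℕ), c = Literature.NumberTheory.Transcendental.KZ.of (r.slab j) - Literature.NumberTheory.Transcendental.KZ.of r} ∪ {c | ∃ (d : ℕ) (A : Fin (d + 1) → (Fin (d + 1) → ℝ) → ℝ) (B : Fin (d + 1) → (Fin (d + 1) → ℝ) → ℝ) (ρ₁ ρ₀ : Fin (d + 1) → Literature.NumberTheory.Transcendental.KZ.IntegralRep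 d), (∀ k, Literature.NumberTheory.Transcendental.IsSemialgebraicFunOn ℚ {z : Fin (d + 1) → ℝ | ∀ i, z i ∈ Set.Icc (0:ℝ) 1} (A k)) ∧ (∀ k, Literature.NumberTheory.Transcendental.IsSemialgebraicFunOn ℚ {z : Fin (d + 1) → ℝ | ∀ i, z i ∈ Set.Icc (0:ℝ) 1} (B k)) ∧ (∀ k, MeasureTheory.IntegrableOn (B k) {z : Fin (d + 1) → ℝ | ∀ i, z i ∈ Set.Icc (0:ℝ) 1}) ∧ (∀ k, ∀ x : Fin d → ℝ, (∀ i, x i ∈ Set.Icc (0:ℝ) 1) → ContinuousOn (fun t : ℝ => A k (Fin.insertNth k t x)) (Set.Icc 0 1) ∧ ∀ t ∈ Set.Ioo (0:ℝ) 1, HasDerivAt (fun s : ℝ => A k (Fin.insertNth k s x)) (B k (Fin.insertNth k t x)) t) ∧ (∀ z : Fin (d + 1) → ℝ, (∀ i, z i ∈ Set.Ioo (0:ℝ) 1) → ∑ k : Fin (d + 1), (-1 : ℝ) ^ (k : ℕ) * B k z = 0) ∧ (∀ k, (ρ₁ k).domain = {x | ∀ i, x i ∈ Set.Icc (0:ℝ)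 1} ∧ (ρ₀ k).domain = {x | ∀ i, x i ∈ Set.Icc (0:ℝ) 1} ∧ Set.EqOn (ρ₁ k).integrand (fun x => A k (Fin.insertNth k 1 x)) {x | ∀ i, x i ∈ Set.Icc (0:ℝ) 1} ∧ Set.EqOn (ρ₀ k).integrand (fun x => A k (Fin.insertNth k 0 x)) {x | ∀ i, x i ∈ Set.Icc (0:ℝ) 1}) ∧ c = ∑ k : Fin (d + 1), ((-1 : ℤ) ^ (k : ℕ)) • (Literature.NumberTheory.Transcendental.KZ.of (ρ₁ k) - Literature.NumberTheory.Transcendental.KZ.of (ρ₀ k))}) := by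
    unfold KZ.relations
    refine (AddSubgroup.closure_le _).mpr ?_
    rintro x (((hx | hx) | hx) | hx)
    · exact AddSubgroup.subset_closure (Or.inl (Or.inl (Or.inl (Or.inl hx))))
    · exact AddSubgroup.subset_closure (Or.inl (Or.inl (Or.inl (Or.inr hx))))
    · exact AddSubgroup.subset_closure (Or.inl (Or.inl (Or.inr hx)))
    · exact h₂ x hx
  -- soundness of the moves: the normal form has value `eval c = 0`
  have hval : r.value = 0 := by
    have h : KZ.eval (c - KZ.of r) = 0 := KZ.relations_le_ker_eval_holds hrel
    rwa [map_sub, KZ.eval_of, hc, zero_sub, neg_eq_zero] at h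
  -- the cube-sector kernel, then climb back
  have hr : KZ.of r ∈ AddSubgroup.closure (Literature.NumberTheory.Transcendental.KZ.domainAddRel ∪ Literature.NumberTheory.Transcendental.KZ.integrandAddRel ∪ Literature.NumberTheory.Transcendental.KZ.changeOfVariablesRel ∪ {c | ∃ (n : ℕ) (r : Literature.NumberTheory.Transcendental.KZ.IntegralRep n) (j : ℕ), c = Literature.NumberTheory.Transcendental.KZ.of (r.slab j) - Literature.NumberTheory.Transcendental.KZ.of r} ∪ {c | ∃ (d : ℕ) (A : Fin (d + 1) → (Fin (d + 1) → ℝ) → ℝ) (B : Fin (d + 1) → (Fin (d + 1) → ℝ) → ℝ) (ρ₁ ρ₀ : Fin (d + 1) → Literature.NumberTheory.Transcendental.KZ.IntegralRep d), (∀ k, Literature.NumberTheory.Transcendental.IsSemialgebraicFunOn ℚ {z : Fin (d + 1) → ℝ | ∀ i, z i ∈ Set.Icc (0:ℝ) 1} (A k)) ∧ (∀ k, Literature.NumberTheory.Transcendental.IsSemialgebraicFunOn ℚ {z : Fin (d + 1) → ℝ | ∀ i, z i ∈ Set.Icc (0:ℝ) 1} (B k)) ∧ (∀ k, MeasureTheory.IntegrableOn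 (B k) {z : Fin (d + 1) → ℝ | ∀ i, z i ∈ Set.Icc (0:ℝ) 1}) ∧ (∀ k, ∀ x : Fin d → ℝ, (∀ i, x i ∈ Set.Icc (0:ℝ) 1) → ContinuousOn (fun t : ℝ => A k (Fin.insertNth k t x)) (Set.Icc 0 1) ∧ ∀ t ∈ Set.Ioo (0:ℝ) 1, HasDerivAt (fun s : ℝ => A k (Fin.insertNth k s x)) (B k (Fin.insertNth k t x)) t) ∧ (∀ z : Fin (d + 1) → ℝ, (∀ i, z i ∈ Set.Ioo (0:ℝ) 1) → ∑ k : Fin (d + 1), (-1 : ℝ) ^ (k : ℕ) * B k z = 0) ∧ (∀ k, (ρ₁ k).domain = {x | ∀ i, x i ∈ Set.Icc (0:ℝ) 1} ∧ (ρ₀ k).domain = {x | ∀ i, x i ∈ Set.Icc (0:ℝ) 1} ∧ Set.EqOn (ρ₁ k).integrand (fun x => A k (Fin.insertNth k 1 x)) {x | ∀ i, x i ∈ Set.Icc (0:ℝ) 1} ∧ Set.EqOn (ρ₀ k).integrand (fun x => A k (Fin.insertNth k 0 x)) {x | ∀ i, x i ∈ Set.Icc (0:ℝ) 1}) ∧ c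 = ∑ k : Fin (d + 1), ((-1 : ℤ) ^ (k : ℕ)) • (Literature.NumberTheory.Transcendental.KZ.of (ρ₁ k) - Literature.NumberTheory.Transcendental.KZ.of (ρ₀ k))}) := h₃ N r hdom hval
  have hcr : c - KZ.of r ∈ AddSubgroup.closure (Literature.NumberTheory.Transcendental.KZ.domainAddRel ∪ Literature.NumberTheory.Transcendental.KZ.integrandAddRel ∪ Literature.NumberTheory.Transcendental.KZ.changeOfVariablesRel ∪ {c | ∃ (n : ℕ) (r : Literature.NumberTheory.Transcendental.KZ.IntegralRep n) (j : ℕ), c = Literature.NumberTheory.Transcendental.KZ.of (r.slab j) - Literature.NumberTheory.Transcendental.KZ.of r} ∪ {c | ∃ (d : ℕ) (A : Fin (d + 1) → (Fin (d + 1) → ℝ) → ℝ) (B : Fin (d + 1) → (Fin (d + 1) → ℝ) → ℝ) (ρ₁ ρ₀ : Fin (d + 1) → Literature.NumberTheory.Transcendental.KZ.IntegralRep d), (∀ k, Literature.NumberTheory.Transcendental.IsSemialgebraicFunOn ℚ {z : Fin (d + 1) → ℝ | ∀ i, z i ∈ Set.Icc (0:ℝ) 1} (A k)) ∧ (∀ k,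 Literature.NumberTheory.Transcendental.IsSemialgebraicFunOn ℚ {z : Fin (d + 1) → ℝ | ∀ i, z i ∈ Set.Icc (0:ℝ) 1} (B k)) ∧ (∀ k, MeasureTheory.IntegrableOn (B k) {z : Fin (d + 1) → ℝ | ∀ i, z i ∈ Set.Icc (0:ℝ) 1}) ∧ (∀ k, ∀ x : Fin d → ℝ, (∀ i, x i ∈ Set.Icc (0:ℝ) 1) → ContinuousOn (fun t : ℝ => A k (Fin.insertNth k t x)) (Set.Icc 0 1) ∧ ∀ t ∈ Set.Ioo (0:ℝ) 1, HasDerivAt (fun s : ℝ => A k (Fin.insertNth k s x)) (B k (Fin.insertNth k t x)) t) ∧ (∀ z : Fin (d + 1) → ℝ, (∀ i, z i ∈ Set.Ioo (0:ℝ) 1) → ∑ k : Fin (d + 1), (-1 : ℝ) ^ (k : ℕ) * B k z = 0) ∧ (∀ k, (ρ₁ k).domain = {x | ∀ i, x i ∈ Set.Icc (0:ℝ) 1} ∧ (ρ₀ k).domain = {x | ∀ i, x i ∈ Set.Icc (0:ℝ) 1} ∧ Set.EqOn (ρ₁ k).integrand (fun x => A k (Fin.insertNth k 1 x)) {x | ∀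 i, x i ∈ Set.Icc (0:ℝ) 1} ∧ Set.EqOn (ρ₀ k).integrand (fun x => A k (Fin.insertNth k 0 x)) {x | ∀ i, x i ∈ Set.Icc (0:ℝ) 1}) ∧ c = ∑ k : Fin (d + 1), ((-1 : ℤ) ^ (k : ℕ)) • (Literature.NumberTheory.Transcendental.KZ.of (ρ₁ k) - Literature.NumberTheory.Transcendental.KZ.of (ρ₀ k))}) := hRG hrel
  have h := add_mem hcr hr
  simpa using h

/-- **Composition** — the crux `ClosedFormCompleteness` BY NAME from the three registered stubs, consumed by
name (`#print axioms` = whitelist ∪ {sorryAx via the three stubs only}). [folklore] -/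
theorem ClosedFormCompleteness_of :
    Summit.KontsevichZagierPeriods.KontsevichZagierPeriods.Theses.CyclesAsDomains.ClosedFormCompleteness := by
  intro c hc
  exact ClosedFormCompleteness_of_stubs stub_cubeNormalForm stub_newtonLeibnizElimination stub_cubeKernel c hc

end Summit.KontsevichZagierPeriods.KontsevichZagierPeriods.Cruxes.ClosedFormCompleteness.Birth

end
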